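/-
Copyright (c) 2026 the pub-hodgecm-mathlib formalisation cell (harness21).  Prover seat hodgecm-mathlib-K2E3-p23 (g0),
Track B «K2-LIT» ∕ h413, line `K2_E3_EllipticInputs` — «by the Weyl integration formula» at the datum pins WITHOUT the (L2D∀)∕(HC-B) letter.  2026-09-03.
-/
import Summits.HodgeConjecture.HodgeConjecture.Theorems.K2E3HTraceOfMatchedPseudoCoeffRHcbFree   -- ★ p855298 (this seat): `integrable_weylIntegrand_of_datumPins`, `integral_mul_eq_innerG_of_isPseudoCoeff_of_integrable`; brings ★ DATUM-JUNCTION v15, ★ PCT-OUT, ★ CLASS-FN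
import HarnessLib

/-!
# K2_E3 road (h413 = stmt-HodgeConjecture-24833): «`Tr(π′(f_π)) = ⟨χ_{π′}, χ_π⟩_e` by the Weyl integration formula» AT THE DATUM PINS, (HC-B)-FREE

Cell `pub/hodgecm-mathlib` (D-0151), Track B «K2-LIT», line `Cruxes/H413/Lines/K2_E3_EllipticInputs.lean` (organ `F0P3cStCharTSPaydown.stub_EllipticInputs`).  Lane
`--supports stmt-HodgeConjecture-24833 --as helper`; THEOREMS ONLY, sorry-free, ★-only imports (no `Cruxes/…/Lines`), axioms TRIO.  Seat K2E3-p23 (g0), self-dealt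
follow-on of ★ p855298 (bus 2026-09-03T22:59Z).

THE POINT.  ★ PCT-OUT `F0P3cStCharTSPctOut.pseudoCoeffTrace_Gqs` derives the carpet relation ★ `Ch12Sec6.PseudoCoeffTrace 𝔇` («By the Weyl integration formula,
`Tr(π′(f_π)) = ⟨χ_{π′}, χ_π⟩_e`», p. 187) from WIF, (M1∀), (C1)(C2)(C3) AND the letter (L2D∀) ★ `L2CharOnTorusAll` («`D_G χ_π ∈ L²(T, dγ)` for every class and every
elliptic Cartan»), which at rung 0 is paid ONLY from Harish-Chandra's local boundedness (HC-B) `normalizedCharacter_locallyBounded` (tier-0 stub 2) — so every E3 road to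
`⟨χ_·, χ_·⟩_{G,e}` through PCT-OUT silently carries stub 2 (K2E3-p15 22:43:25Z (2); K2E3-r02 «under-lettering» of rows 15∕16∕18).  (L2D∀) entered PCT-OUT for ONE
purpose: the per-torus convergence hypotheses of the dictionary's WIF.  At the datum those are NOT letters (★ p855298 §1 `integrable_weylIntegrand_of_datumPins`, from
★ ROAD UP-TR (A0) over the tube Jacobians: every torus term is `dγ`-integrable as soon as `f · α ∈ L¹(G)`).  Hence:

**`pseudoCoeffTrace_of_datumPins`** — `Ch12Sec6.PseudoCoeffTrace 𝔇` at the organ's datum from the PINS ALONE (`hC01 hC04 hcanQ hC05 hE hchar hAll hHaar hcart hHaarG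
hker hcovA hncA hcptA hinvT hcoreT eDG`, binders token for token those of the block `hBlock′`): NO (L2D∀), NO (HC-B), NO WIF∕(C1)(C2)(C3) hypotheses (all ★ at the pins:
WIF ★ `weylIntegrationFormula_of_datumPins` + ★ JAC-ELL C8; (C1)(C2)(C3) ★ CARTAN-FIELDS∕NULL; class-function property ★ CLASS-FN + ★ admissibility of `U(Φ₃)(L⁺_v)`).
USE: replace `F0P3cStCharTSPctOut.pseudoCoeffTrace_Gqs … hWIF hC1 hC2 hC3 hL2` by `pseudoCoeffTrace_of_datumPins …` in any E3 file whose only use of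
`normalizedCharacter_locallyBounded` was `hL2`.  HONEST LABEL: count-neutral `--supports` helper; closes no socket by itself; HC_CM is proved only modulo the 7
printed citations (2 remaining named inputs: hLiu418 = stmt-HodgeConjecture-24832, h413 = stmt-HodgeConjecture-24833) until rung 0 closes.

## References
* [Rogawski1990] J. D. Rogawski, *Automorphic Representations of Unitary Groups in Three Variables*, Ann. of Math. Stud. 123 (1990): §12.6 p. 187 («By the Weyl
  integration formula, `Tr(π′(f_π)) = ⟨χ_{π′}, χ_π⟩_e`»); §12.5 pp. 182–184; §1.6 p. 6; §3.6 pp. 28–31.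
* [HarishChandra1970] Harish-Chandra (notes by G. van Dijk), *Harmonic analysis on reductive p-adic groups*, LNM 162 (1970), Part V Lemmas 20, 22, 42.
-/

set_option autoImplicit false
set_option linter.dupNamespace false  -- the mandated namespace repeats `HodgeConjecture`

noncomputable section

open NumberField IsDedekindDomain MeasureTheory Measure Set Filter Topology
open scoped Matrix MatrixGroups NNReal ENNReal ComplexConjugate
open Literature.MeasureTheory.Group
open Literature.NumberTheory.Rogawski1990 Literature.NumberTheory.Automorphic Literature.NumberTheory.Automorphic.UnitaryGroup
open Literature.NumberTheory.Rogawski1990.Ch12Sec5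
open Summit.HodgeConjecture.HodgeConjecture.Cruxes.H413
open Summit.HodgeConjecture.HodgeConjecture.Cruxes.H413.F0P3cStCharTSTorusDefs
open Summit.HodgeConjecture.HodgeConjecture.Cruxes.H413.K2E3HTraceOfMatchedPseudoCoeffRHcbFree

namespace Summit.HodgeConjecture.HodgeConjecture.Cruxes.H413.K2E3PseudoCoeffTraceHcbFree

variable (L : Type) [Field L] [NumberField L] [IsCMField L] (v : HeightOneSpectrum (𝓞 ↥(maximalRealSubfield L)))

set_option maxHeartbeats 3200000 in
set_option synthInstance.maxHeartbeats 400000 in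
/-- **«PCT AT THE DATUM PINS, (HC-B)-FREE».**  `v` non-split (`hns`); at a §12.5 datum `𝔇` on `(U(Φ₃)(L⁺_v), Hv)` whose `G`-side fields are pinned as in the organ's block
`hBlock′` — Haar measure (`hC01`), canonical orbital measures (`hC04`, `hcanQ`), regular set (`hC05`), elliptic set (`hE`), characters with (M1) for EVERY class (`hchar`),
Cartan representatives `{M} ∪ 𝒞_G` (`hAll hHaar hcart hHaarG hker hcovA hncA hcptA hinvT hcoreT`) and `D_G` the closed form (`eDG`) — the carpet relation ★
`Ch12Sec6.PseudoCoeffTrace 𝔇` HOLDS: for every pseudo-coefficient `f` of `π` and every class `π′`, `Tr π′(f) = ⟨χ_{π′}, χ_π⟩_{G,e}`.  = ★ PCT-OUT with `hWIF hC1 hC2 hC3`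
DERIVED at the pins (★ DATUM-JUNCTION v15's lines) and `hL2` REPLACED by ★ p855298 §1 (torus convergence from `f · χ_{π′} ∈ L¹(G)`, which holds since `f ∈ C_c^∞(G)`
and `χ_{π′} ∈ L¹_loc`). [cite: Rogawski1990, §12.6 p. 187; §12.5 pp. 182, 184] [cite: HarishChandra1970, Lemma 42] -/
theorem pseudoCoeffTrace_of_datumPins
    (hns : ∀ w : PlacesOver L v, IsCMField.complexConj L • w.1 = w.1)
    [MeasurableSpace (Gqs L v)] [BorelSpace (Gqs L v)]
    [∀ γ' : Gqs L v, MeasurableSpace (Gqs L v ⧸ Subgroup.centralizer ({γ'} : Set (Gqs L v)))]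
    [∀ γ' : Gqs L v, BorelSpace (Gqs L v ⧸ Subgroup.centralizer ({γ'} : Set (Gqs L v)))]
    [MeasurableSpace (Gqs L v ⧸ Subgroup.center (Gqs L v))]
    (νQv : Measure (Gqs L v)) [νQv.IsHaarMeasure] [νQv.IsMulRightInvariant]
    {Hv : Type} [Group Hv] [TopologicalSpace Hv] [IsTopologicalGroup Hv] [MeasurableSpace Hv]
    (mQv : OrbitalMeasureFamily (Gqs L v))
    (𝔇 : Ch12Sec5.EllipticData (Gqs L v) Hv)
    (hC01 : 𝔇.μG = νQv)
    (hC04 : 𝔇.orb = mQv)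
    (hcanQ : mQv.IsCanonical (fun γ : Gqs L v => IsRegularElt (γ.val : GL (Fin 3) (UnitaryGroup.LocalRing L v))) νQv)
    (hC05 : ∀ γ : Gqs L v, γ ∈ 𝔇.regG ↔ IsRegularElt (γ.val : GL (Fin 3) (UnitaryGroup.LocalRing L v)))
    (hE : ∀ γ : Gqs L v, γ ∈ 𝔇.ellG ↔ IsRegularElt (γ.val : GL (Fin 3) (UnitaryGroup.LocalRing L v)) ∧ γ ∉ hyperbolicSet L v)
    (hchar : ∀ π : IrrClass (Gqs L v), Measurable (𝔇.char π) ∧ LocallyIntegrable (𝔇.char π) 𝔇.μG ∧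
      (∀ x ∈ 𝔇.regG, ∀ᶠ y in 𝓝 x, 𝔇.char π y = 𝔇.char π x) ∧
      ∀ φ : Gqs L v → ℂ, IsLocSmooth φ → π.smoothTrace 𝔇.μG φ = ∫ x, φ x * 𝔇.char π x ∂𝔇.μG)
    (hAll : ∀ T : Subgroup (Gqs L v), T ∈ 𝔇.cartanAll ↔ T = (cmBorelTriple L 3 v).M ∨ T ∈ 𝔇.cartanG)
    (hHaar : (𝔇.μT (cmBorelTriple L 3 v).M).IsHaarMeasure)
    (hcart : ∀ T ∈ 𝔇.cartanG, IsCompact (T : Set (Gqs L v)) ∧ ∃ γ₀ : Gqs L v, IsRegularElt (γ₀.val : GL (Fin 3) (UnitaryGroup.LocalRing L v)) ∧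
      T = Subgroup.centralizer ({γ₀} : Set (Gqs L v)))
    (hHaarG : ∀ T ∈ 𝔇.cartanG, (𝔇.μT T).IsHaarMeasure)
    (hker : ∀ T ∈ 𝔇.cartanG, ∃ s : Finset (Subgroup ↥T), (∀ K ∈ s, IsClosed (K : Set ↥T) ∧ ¬ IsOpen (K : Set ↥T)) ∧
      ∀ t : ↥T, ¬ IsRegularElt ((t : Gqs L v).val : GL (Fin 3) (UnitaryGroup.LocalRing L v)) → ∃ K ∈ s, t ∈ K)
    (hcovA : ∀ γ : Gqs L v, IsRegularElt (γ.val : GL (Fin 3) (UnitaryGroup.LocalRing L v)) →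
      ∃ T' ∈ 𝔇.cartanAll, ∃ x : Gqs L v, ∀ g : Gqs L v, g ∈ Subgroup.centralizer ({γ} : Set (Gqs L v)) ↔ x⁻¹ * g * x ∈ T')
    (hncA : ∀ T' ∈ 𝔇.cartanAll, ∀ T'' ∈ 𝔇.cartanAll, T' ≠ T'' → ∀ y : Gqs L v, ¬ ∀ h : Gqs L v, h ∈ T'' ↔ y⁻¹ * h * y ∈ T')
    (hcptA : ∀ T' ∈ 𝔇.cartanAll, T' ≠ (cmBorelTriple L 3 v).M → IsCompact (T' : Set (Gqs L v)))
    (hinvT : ∀ T' ∈ 𝔇.cartanAll, (𝔇.μT T').IsInvInvariant)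
    (hcoreT : ∀ T' ∈ 𝔇.cartanAll, 𝔇.μT T' (compactCore ↥T') = 1)
    (eDG : ∀ g : Gqs L v, 𝔇.DG g = ((NNReal.sqrt (NNReal.sqrt ((∏ w : PlacesOver L v, Literature.NumberTheory.GaloisRepresentations.IsNonarchimedeanLocalField.normAbs (w.1.adicCompletion L) (((g.val : GL (Fin 3) (UnitaryGroup.LocalRing L v)).val.charpoly.discr) w)) * ((∏ w : PlacesOver L v, Literature.NumberTheory.GaloisRepresentations.IsNonarchimedeanLocalField.normAbs (w.1.adicCompletion L) (((g.val : GL (Fin 3) (UnitaryGroup.LocalRing L v)).val.det) w)) ^ 2)⁻¹)) : NNReal) : ℝ)) :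
    Ch12Sec6.PseudoCoeffTrace 𝔇 := by
  classical
  haveI : TotallyDisconnectedSpace (Gqs L v) := totallyDisconnectedSpace_cmDatum_local L 3 (qsForm L) v
  intro π π' f hf
  obtain ⟨hmeas, hli, hlc, htr⟩ := hchar π'
  -- (1) the trace as an integral against `χ_{π′}`
  rw [htr f hf.1]
  -- (2) `χ_{π′}` is a class function on `G^r` (★ CLASS-FN over ★ admissibility of `U(Φ₃)(L⁺_v)`)
  have hregconj : ∀ γ ∈ 𝔇.regG, ∀ x : Gqs L v, x * γ * x⁻¹ ∈ 𝔇.regG := fun γ hγ x =>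
    (hC05 _).2 ((isRegularElt_iff_of_isConj_local L (qsForm L) v (b := γ) (b' := x * γ * x⁻¹) (isConj_iff.2 ⟨x, rfl⟩)).1 ((hC05 γ).1 hγ))
  have hcl : IsClassFunOn 𝔇.regG (𝔇.char π') := by
    have htr' := htr
    rw [hC01] at htr'
    exact F0P3cStCharTSClassFn.isClassFunOn_of_locallyConstant_of_smoothTrace νQv hregconj hlc π'
      (F0P3LocalIrrepAdmissibleOfCuspidal.isAdmissible_irrClass_quasiSplit_of_cuspidal L v
        (F0P3LocalIrrepAdmissibleThree.isSupercuspidal_of_subsingleton_coinvariants L v hns) π') htr'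
  -- (3) WIF and (C1)(C2)(C3) at the pins (★ DATUM-JUNCTION v15's lines)
  have hShapeA : ∀ T' ∈ 𝔇.cartanAll, ∃ γ₀ : Gqs L v, IsRegularElt (γ₀.val : GL (Fin 3) (UnitaryGroup.LocalRing L v)) ∧
      T' = Subgroup.centralizer ({γ₀} : Set (Gqs L v)) := fun T' hT' => by
    rcases (hAll T').1 hT' with h | h
    · subst h; obtain ⟨m₀, -, hreg, hZ⟩ := F0P3cStCharTSCartanReps.exists_isRegularElt_centralizer_eq_cmTorus L v hns; exact ⟨m₀, hreg, hZ.symm⟩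
    · exact (hcart T' h).2
  have hHaarT : ∀ T' ∈ 𝔇.cartanAll, (𝔇.μT T').IsHaarMeasure := fun T' hT' => by
    rcases (hAll T').1 hT' with h | h
    · subst h; exact hHaar
    · exact hHaarG T' h
  have hWIF : 𝔇.WeylIntegrationFormula := F0P3cStCharTSWeylDatumPinsWIF.weylIntegrationFormula_of_datumPins L v hns νQv mQv 𝔇 hC01 hC04 hcanQ
    hC05 hShapeA hcovA hncA hcptA hHaarT hinvT hcoreT eDG (F0P3cStCharTSJacCartanTerminus.tubeJacobianSocket_compactCartan L v hns νQv)
  have hC2cert : 𝔇.EllCartanAE :=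
    F0P3cStCharTSCartanFields.ellCartanAE_of_compact_centralizers L v 𝔇 hE hcart
      (F0P3cStCharTSCartanNull.cartanNull_of_rootKernels L v 𝔇 hHaarG (fun T hT => (hcart T hT).1) hker)
  have hC1cert : 𝔇.EllCartanSubset := fun T hT => (hAll T).2 (Or.inr hT)
  have hC3cert : 𝔇.NonEllCartanAE :=
    F0P3cStCharTSCartanFields.nonEllCartanAE_of_split L v 𝔇 hC05 hE (fun T hT hTn => ((hAll T).1 hT).resolve_right hTn) hHaar
  -- (4) convergence: `f · χ_{π′} ∈ L¹(G)` (`f ∈ C_c^∞`, `χ_{π′} ∈ L¹_loc`), and the torus terms by ★ p855298 §1 — no (L2D)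
  have hint : Integrable (fun g => f g * 𝔇.char π' g) 𝔇.μG := by
    have h := hli.integrable_smul_left_of_hasCompactSupport hf.1.1.continuous hf.1.2
    simpa only [smul_eq_mul] using h
  have hintT := integrable_weylIntegrand_of_datumPins L v hns νQv mQv 𝔇 hC01 hC04 hcanQ hC05 hShapeA hcptA hHaarT hinvT hcoreT eDG f
    hf.1.1.continuous.measurable (𝔇.char π') hcl hint
  exact integral_mul_eq_innerG_of_isPseudoCoeff_of_integrable 𝔇 hWIF hC1cert hC2cert hC3cert hmeas hcl hf hint hintT

end Summit.HodgeConjecture.HodgeConjecture.Cruxes.H413.K2E3PseudoCoeffTraceHcbFree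

end
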